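import Summits.FinalStateConjecture.FinalStateConjecture.Theorems.PhotonSphereChannelsExteriorEnergyRW

/-!
# Route PhotonSphereChannels — linearity, energy tails and the sub-linear growth of finite-energy data

Helper file for the sub-goal `stub_exhaustionDensity` of stub `stub_outgoingEnergyExhaustion` (H4) of
line `isolated-kerr-connected-hull` (crux stmt-FinalStateConjecture-14075), over the Literature vocabulary
`ReggeWheeler.{energyDensity, IsSolution}`:

* `RW.IsSolution.sub` — differences of global `C²` solutions of `ψ_tt − ψ_xx + Vψ = 0` are solutions;
* `RW.exists_lintegral_abs_gt_le` — tails `∫⁻_{R < |x|} F` of a finite lower integral on the line are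
  eventually `≤ ε` (continuity from above of the measure `F dx`);
* `RW.sq_integral_le` — Cauchy–Schwarz `(∫_p^q u)² ≤ (q − p) ∫_p^q u²`, and the growth bounds
  `RW.sq_le_of_deriv_tail_right/left`: `f(x)² ≤ 2 f(a)² + 2 |x − a| τ` when `∫ f'² ≤ τ` between `a`
  and `x`;
* `RW.data_sq_bound` — finite energy does NOT put `f = ψ(0, ·)` in `L²` (the Regge–Wheeler potential
  is integrable at both ends), but it makes `f² = o(|x|)`: `f(x)² ≤ C₁ + 4 R τ₀` on `|x| ≤ 2R` with
  `τ₀` a tail of the energy, as small as we please — exactly what the linear-scale cutoff needs;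
* the registered summary `stub_h4EnergyTails`.

No new definitions; standard material. [folklore]
-/

namespace Summit.FinalStateConjecture.FinalStateConjecture.Theorems

-- every `Summit.FinalStateConjecture.FinalStateConjecture.…` name repeats the summit = sub-problem
-- segment (D-0017 layout), as in every landed `…Theorems` file of this route
set_option linter.dupNamespace false

open MeasureTheory Set Filter Topology Metric
open scoped ENNReal
open Literature.Geometry.Lorentzian Literature.Geometry.Lorentzian.ReggeWheeler

noncomputable section

namespace RW

variable {V : ℝ → ℝ} {ψ φ : ℝ → ℝ → ℝ}

/-- **Differences of global solutions are global solutions** (linearity of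
`ψ_tt − ψ_xx + Vψ = 0`). [folklore] -/
theorem IsSolution.sub (hψ : IsSolution V ψ) (hφ : IsSolution V φ) :
    IsSolution V (fun t x ↦ ψ t x - φ t x) := by
  refine ⟨?_, fun z ↦ ?_⟩
  · have h : Function.uncurry (fun t x ↦ ψ t x - φ t x)
        = fun p ↦ Function.uncurry ψ p - Function.uncurry φ p := by
      funext p
      rfl
    rw [h]
    exact hψ.1.sub hφ.1
  · have hs1 : ∀ x, ContDiff ℝ 2 (fun τ ↦ ψ τ x) := fun x ↦
      hψ.1.comp (contDiff_id.prodMk contDiff_const)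
    have hs2 : ∀ t, ContDiff ℝ 2 (fun y ↦ ψ t y) := fun t ↦
      hψ.1.comp (contDiff_const.prodMk contDiff_id)
    have hp1 : ∀ x, ContDiff ℝ 2 (fun τ ↦ φ τ x) := fun x ↦
      hφ.1.comp (contDiff_id.prodMk contDiff_const)
    have hp2 : ∀ t, ContDiff ℝ 2 (fun y ↦ φ t y) := fun t ↦
      hφ.1.comp (contDiff_const.prodMk contDiff_id)
    show iteratedDeriv 2 (fun τ ↦ ψ τ z.2 - φ τ z.2) z.1
        - iteratedDeriv 2 (fun y ↦ ψ z.1 y - φ z.1 y) z.2 + V z.2 * (ψ z.1 z.2 - φ z.1 z.2) = 0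
    rw [iteratedDeriv_fun_sub (hs1 z.2).contDiffAt (hp1 z.2).contDiffAt,
      iteratedDeriv_fun_sub (hs2 z.1).contDiffAt (hp2 z.1).contDiffAt]
    have e1 := hψ.2 z
    have e2 := hφ.2 z
    unfold IsSolutionAt at e1 e2
    linear_combination e1 - e2

/-- **Tails of a finite lower integral are eventually small**: if `∫⁻ F < ⊤` then for every `ε > 0`
the integrals `∫⁻_{R < |x|} F` are `≤ ε` for all large `R` (continuity from above of the measure
`F · dx` along the shrinking sets `{R < |x|}`, whose intersection is empty). [folklore] -/
theorem exists_lintegral_abs_gt_le {F : ℝ → ℝ≥0∞} (hF : ∫⁻ x, F x < ⊤) {ε : ℝ≥0∞} (hε : 0 < ε) :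
    ∃ R₀ : ℝ, 0 ≤ R₀ ∧ ∀ R, R₀ ≤ R → ∫⁻ x in {x | R < |x|}, F x ≤ ε := by
  have hmeas : ∀ R : ℝ, MeasurableSet {x : ℝ | R < |x|} := fun R ↦
    measurableSet_lt measurable_const continuous_abs.measurable
  have happly : ∀ R : ℝ, volume.withDensity F {x | R < |x|} = ∫⁻ x in {x | R < |x|}, F x :=
    fun R ↦ withDensity_apply F (hmeas R)
  have hanti : Antitone (fun R : ℝ ↦ {x : ℝ | R < |x|}) :=
    fun a b hab x (hx : b < |x|) ↦ lt_of_le_of_lt hab hx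
  have hinter : (⋂ R : ℝ, {x : ℝ | R < |x|}) = ∅ := by
    refine eq_empty_of_forall_notMem fun x hx ↦ ?_
    have h : x ∈ {y : ℝ | |x| < |y|} := mem_iInter.1 hx |x|
    exact lt_irrefl (|x|) h
  have hfin : ∃ R : ℝ, volume.withDensity F {x | R < |x|} ≠ ⊤ := ⟨0, by
    rw [happly]
    exact ((setLIntegral_le_lintegral _ _).trans_lt hF).ne⟩
  have ht := tendsto_measure_iInter_atTop (μ := volume.withDensity F)
    (fun R ↦ (hmeas R).nullMeasurableSet) hanti hfin
  rw [hinter, measure_empty] at ht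
  have hev : ∀ᶠ R in atTop, volume.withDensity F {x | R < |x|} < ε := (tendsto_order.1 ht).2 ε hε
  obtain ⟨R₁, hR₁⟩ := eventually_atTop.1 hev
  refine ⟨max R₁ 0, le_max_right _ _, fun R hR ↦ ?_⟩
  rw [← happly]
  exact (hR₁ R ((le_max_left _ _).trans hR)).le

/-- **Cauchy–Schwarz on an interval**: `(∫_p^q u)² ≤ (q − p) ∫_p^q u²` for continuous `u` and
`p ≤ q` (from `0 ≤ ∫ (u − m)²` with `m` the mean of `u`). [folklore] -/
theorem sq_integral_le {u : ℝ → ℝ} (hu : Continuous u) {p q : ℝ} (hpq : p ≤ q) :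
    (∫ y in p..q, u y) ^ 2 ≤ (q - p) * ∫ y in p..q, u y ^ 2 := by
  rcases hpq.eq_or_lt with h | h
  · subst h
    simp
  have hdpos : 0 < q - p := sub_pos.2 h
  have hi1 : IntervalIntegrable u volume p q := hu.intervalIntegrable p q
  have hi2 : IntervalIntegrable (fun y ↦ u y ^ 2) volume p q := (hu.pow 2).intervalIntegrable p q
  have h0 : 0 ≤ ∫ y in p..q, (u y - (∫ y in p..q, u y) / (q - p)) ^ 2 :=
    intervalIntegral.integral_nonneg hpq fun y _ ↦ sq_nonneg _
  have hexp : ∫ y in p..q, (u y - (∫ y in p..q, u y) / (q - p)) ^ 2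
      = (∫ y in p..q, u y ^ 2) - 2 * ((∫ y in p..q, u y) / (q - p)) * (∫ y in p..q, u y)
        + ((∫ y in p..q, u y) / (q - p)) ^ 2 * (q - p) := by
    have e : (fun y ↦ (u y - (∫ y in p..q, u y) / (q - p)) ^ 2)
        = fun y ↦ (u y ^ 2 - (2 * ((∫ y in p..q, u y) / (q - p))) * u y)
          + ((∫ y in p..q, u y) / (q - p)) ^ 2 := by
      funext y
      ring
    rw [e, intervalIntegral.integral_add (hi2.sub (hi1.const_mul _)) intervalIntegrable_const,
      intervalIntegral.integral_sub hi2 (hi1.const_mul _), intervalIntegral.integral_const_mul,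
      intervalIntegral.integral_const]
    simp only [smul_eq_mul]
    ring
  rw [hexp] at h0
  have hcd : (∫ y in p..q, u y) / (q - p) * (q - p) = ∫ y in p..q, u y := by
    field_simp
  have h1 := mul_nonneg hdpos.le h0
  have h2 : (q - p) * ((∫ y in p..q, u y ^ 2) - 2 * ((∫ y in p..q, u y) / (q - p))
      * (∫ y in p..q, u y) + ((∫ y in p..q, u y) / (q - p)) ^ 2 * (q - p))
      = (q - p) * (∫ y in p..q, u y ^ 2) - (∫ y in p..q, u y) ^ 2 := by
    have : (q - p) * ((∫ y in p..q, u y ^ 2) - 2 * ((∫ y in p..q, u y) / (q - p))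
        * (∫ y in p..q, u y) + ((∫ y in p..q, u y) / (q - p)) ^ 2 * (q - p))
        = (q - p) * (∫ y in p..q, u y ^ 2)
          - 2 * ((∫ y in p..q, u y) / (q - p) * (q - p)) * (∫ y in p..q, u y)
          + ((∫ y in p..q, u y) / (q - p) * (q - p)) ^ 2 := by ring
    rw [this, hcd]
    ring
  linarith

/-- **Growth to the right from a derivative tail bound**: if `f ∈ C¹` and `∫_a^x f'² ≤ τ` for all
`x ≥ a`, then `f(x)² ≤ 2 f(a)² + 2 (x − a) τ` for `x ≥ a`. [folklore] -/
theorem sq_le_of_deriv_tail_right {f : ℝ → ℝ} (hf : ContDiff ℝ 1 f) {a τ : ℝ}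
    (hτ : ∀ x, a ≤ x → ∫ y in a..x, deriv f y ^ 2 ≤ τ) {x : ℝ} (hx : a ≤ x) :
    f x ^ 2 ≤ 2 * f a ^ 2 + 2 * (x - a) * τ := by
  have hdiff : Differentiable ℝ f := hf.differentiable (by simp)
  have hcont : Continuous (deriv f) := hf.continuous_deriv le_rfl
  have hftc : ∫ y in a..x, deriv f y = f x - f a :=
    intervalIntegral.integral_deriv_eq_sub (fun y _ ↦ hdiff y) (hcont.intervalIntegrable _ _)
  have hcs := sq_integral_le hcont hx
  rw [hftc] at hcs
  have h2 : (x - a) * ∫ y in a..x, deriv f y ^ 2 ≤ (x - a) * τ :=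
    mul_le_mul_of_nonneg_left (hτ x hx) (sub_nonneg.2 hx)
  nlinarith [sq_nonneg (2 * f a - f x)]

/-- **Growth to the left from a derivative tail bound**: if `f ∈ C¹` and `∫_x^a f'² ≤ τ` for all
`x ≤ a`, then `f(x)² ≤ 2 f(a)² + 2 (a − x) τ` for `x ≤ a`. [folklore] -/
theorem sq_le_of_deriv_tail_left {f : ℝ → ℝ} (hf : ContDiff ℝ 1 f) {a τ : ℝ}
    (hτ : ∀ x, x ≤ a → ∫ y in x..a, deriv f y ^ 2 ≤ τ) {x : ℝ} (hx : x ≤ a) :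
    f x ^ 2 ≤ 2 * f a ^ 2 + 2 * (a - x) * τ := by
  have hdiff : Differentiable ℝ f := hf.differentiable (by simp)
  have hcont : Continuous (deriv f) := hf.continuous_deriv le_rfl
  have hftc : ∫ y in x..a, deriv f y = f a - f x :=
    intervalIntegral.integral_deriv_eq_sub (fun y _ ↦ hdiff y) (hcont.intervalIntegrable _ _)
  have hcs := sq_integral_le hcont hx
  rw [hftc] at hcs
  have h2 : (a - x) * ∫ y in x..a, deriv f y ^ 2 ≤ (a - x) * τ :=
    mul_le_mul_of_nonneg_left (hτ x hx) (sub_nonneg.2 hx)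
  nlinarith [sq_nonneg (2 * f a - f x)]

/-- **Sub-linear growth of finite-energy data.** If `f ∈ C¹`, `e ≥ f'²` is continuous, nonnegative
and `∫⁻ e < ⊤`, then for every `η > 0` there are `C₁ ≥ 0` and `0 ≤ τ₀ ≤ η` with
`f(x)² ≤ C₁ + 4 R τ₀` whenever `|x| ≤ 2R` (the slope `τ₀` is a tail of `∫ e`, hence as small as we
please; `f` itself need not be square integrable or bounded). [folklore] -/
theorem data_sq_bound {f e : ℝ → ℝ} (hf : ContDiff ℝ 1 f) (hec : Continuous e)
    (he0 : ∀ x, 0 ≤ e x) (hfe : ∀ x, deriv f x ^ 2 ≤ e x)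
    (hE : ∫⁻ x, ENNReal.ofReal (e x) < ⊤) {η : ℝ} (hη : 0 < η) :
    ∃ C₁ τ₀ : ℝ, 0 ≤ C₁ ∧ 0 ≤ τ₀ ∧ τ₀ ≤ η ∧
      ∀ R x : ℝ, |x| ≤ 2 * R → f x ^ 2 ≤ C₁ + 4 * R * τ₀ := by
  obtain ⟨ρ₀, hρ₀, hρ₀tail⟩ := exists_lintegral_abs_gt_le hE (ENNReal.ofReal_pos.2 hη)
  have hτE : ∫⁻ x in {x | ρ₀ < |x|}, ENNReal.ofReal (e x) ≤ ENNReal.ofReal η := hρ₀tail ρ₀ le_rfl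
  have hτEfin : ∫⁻ x in {x | ρ₀ < |x|}, ENNReal.ofReal (e x) ≠ ⊤ :=
    ((setLIntegral_le_lintegral _ _).trans_lt hE).ne
  have hτ₀η : (∫⁻ x in {x | ρ₀ < |x|}, ENNReal.ofReal (e x)).toReal ≤ η := by
    have h := ENNReal.toReal_mono ENNReal.ofReal_ne_top hτE
    rwa [ENNReal.toReal_ofReal hη.le] at h
  have hτ₀nn : 0 ≤ (∫⁻ x in {x | ρ₀ < |x|}, ENNReal.ofReal (e x)).toReal := ENNReal.toReal_nonneg
  have hcontf' : Continuous (deriv f) := hf.continuous_deriv le_rfl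
  have hpiece : ∀ p q : ℝ, p ≤ q → Ioc p q ⊆ {x | ρ₀ < |x|} →
      ∫ y in p..q, deriv f y ^ 2 ≤ (∫⁻ x in {x | ρ₀ < |x|}, ENNReal.ofReal (e x)).toReal := by
    intro p q hpq hsub
    have h1 : ∫ y in p..q, deriv f y ^ 2 ≤ ∫ y in p..q, e y :=
      intervalIntegral.integral_mono_on hpq ((hcontf'.pow 2).intervalIntegrable _ _)
        (hec.intervalIntegrable _ _) fun y _ ↦ hfe y
    have h2 : ENNReal.ofReal (∫ y in p..q, e y) ≤ ∫⁻ x in {x | ρ₀ < |x|}, ENNReal.ofReal (e x) := by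
      rw [← WaveEnergy.lintegral_Ioc_eq_ofReal_intervalIntegral hec he0 hpq]
      exact lintegral_mono_set hsub
    have h3 := ENNReal.toReal_mono hτEfin h2
    rw [ENNReal.toReal_ofReal (intervalIntegral.integral_nonneg hpq fun y _ ↦ he0 y)] at h3
    exact h1.trans h3
  have hright : ∀ x, ρ₀ + 1 ≤ x → f x ^ 2 ≤ 2 * f (ρ₀ + 1) ^ 2
      + 2 * (x - (ρ₀ + 1)) * (∫⁻ x in {x | ρ₀ < |x|}, ENNReal.ofReal (e x)).toReal := fun x hx ↦
    sq_le_of_deriv_tail_right hf (fun y hy ↦ hpiece _ y hy fun z hz ↦ by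
      show ρ₀ < |z|
      rw [abs_of_pos (by linarith [hz.1])]
      linarith [hz.1]) hx
  have hleft : ∀ x, x ≤ -(ρ₀ + 1) → f x ^ 2 ≤ 2 * f (-(ρ₀ + 1)) ^ 2
      + 2 * (-(ρ₀ + 1) - x) * (∫⁻ x in {x | ρ₀ < |x|}, ENNReal.ofReal (e x)).toReal := fun x hx ↦
    sq_le_of_deriv_tail_left hf (fun y hy ↦ hpiece y _ hy fun z hz ↦ by
      show ρ₀ < |z|
      rw [abs_of_neg (by linarith [hz.2])]
      linarith [hz.2]) hx
  obtain ⟨C, hC⟩ : ∃ C, ∀ x ∈ Icc (-(ρ₀ + 1)) (ρ₀ + 1), ‖f x ^ 2‖ ≤ C :=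
    isCompact_Icc.exists_bound_of_continuousOn ((hf.continuous.pow 2).continuousOn)
  refine ⟨|C| + 2 * (f (ρ₀ + 1) ^ 2 + f (-(ρ₀ + 1)) ^ 2),
    (∫⁻ x in {x | ρ₀ < |x|}, ENNReal.ofReal (e x)).toReal, by positivity, hτ₀nn, hτ₀η,
    fun R x hx ↦ ?_⟩
  have hRτ : 0 ≤ 4 * R * (∫⁻ x in {x | ρ₀ < |x|}, ENNReal.ofReal (e x)).toReal := by
    nlinarith [abs_nonneg x]
  rcases le_or_gt x (-(ρ₀ + 1)) with h | h
  · have h1 := hleft x h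
    have : -(ρ₀ + 1) - x ≤ 2 * R := by linarith [neg_le_abs x]
    nlinarith [sq_nonneg (f (ρ₀ + 1)), abs_nonneg C]
  rcases le_or_gt (ρ₀ + 1) x with h' | h'
  · have h1 := hright x h'
    have : x - (ρ₀ + 1) ≤ 2 * R := by linarith [le_abs_self x]
    nlinarith [sq_nonneg (f (-(ρ₀ + 1))), abs_nonneg C]
  · have h1 := hC x ⟨h.le, h'.le⟩
    rw [Real.norm_eq_abs] at h1
    have : f x ^ 2 ≤ |C| := (le_abs_self _).trans (h1.trans (le_abs_self C))
    nlinarith [sq_nonneg (f (ρ₀ + 1)), sq_nonneg (f (-(ρ₀ + 1)))]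

/-- **Registered summary `stub_h4EnergyTails`** (sub-goal of `stub_exhaustionDensity`, crux
stmt-FinalStateConjecture-14075, line `isolated-kerr-connected-hull`): sub-linear growth of the square of
a `C¹` function whose derivative is square integrable, with slope a tail of the integral. [folklore] -/
theorem stub_h4EnergyTails :
    ∀ (f e : ℝ → ℝ), ContDiff ℝ 1 f → Continuous e → (∀ x, 0 ≤ e x) → (∀ x, deriv f x ^ 2 ≤ e x) →
      MeasureTheory.lintegral MeasureTheory.volume (fun x ↦ ENNReal.ofReal (e x)) < ⊤ →
      ∀ η : ℝ, 0 < η → ∃ C₁ τ₀ : ℝ, 0 ≤ C₁ ∧ 0 ≤ τ₀ ∧ τ₀ ≤ η ∧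
        ∀ R x : ℝ, |x| ≤ 2 * R → f x ^ 2 ≤ C₁ + 4 * R * τ₀ :=
  fun _ _ hf hec he0 hfe hE _ hη ↦ data_sq_bound hf hec he0 hfe hE hη

end RW

end

end Summit.FinalStateConjecture.FinalStateConjecture.Theorems
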